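import Literature.AlgebraicGeometry.Deformation.SmallExtensionFactorization
import HarnessLib

/-!
# [Schlessinger1968, proof of Thm. 2.11, p. 214]: `S/J ×_{S/(J+K)} S/K ≅ S/(J ∩ K)` — the quotients of a ring by
two ideals form a CARTESIAN square over the quotient by their sum

Family `hodge` (computation cell `pub-hsemireg`, LIT-W seat «Pridham / derived deformation theory as printed»), layer
`Literature/AlgebraicGeometry/Deformation`. Vocabulary of `T1Lifting.lean` (`IsCartesian`: a commutative square of
`k`-algebras in which compatible pairs lift uniquely — any model of the fibre product) and of
`SmallExtensionFactorization.lean` (`ArtAlg.ofQuotient B J` = `B/J` as an object of `Art_k` for a proper ideal `J`).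

[Schlessinger1968, proof of Thm. 2.11 (1), p. 214]: «… we may enlarge `J`, say, so that `J + K = J_q`, without
changing the intersection `J ∩ K`. Then `S/J ×_{S/J_q} S/K ≅ S/(J ∩ K)` so that by (H₁) (see (2.14)) we may conclude
that `J ∩ K` is in `𝒮`.» THIS FILE proves the ring-theoretic identity used there, for any commutative `k`-algebra `B`
and any two ideals `J, K`: the square of canonical projections
```
B/(J ⊓ K) ——→ B/J
   |            |
   v            v
  B/K  ——→  B/(J ⊔ K)
```
is cartesian (`Ideal.isCartesian_quotient_inf`: commutative; a pair `(x̄ ∈ B/J, ȳ ∈ B/K)` with the same image in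
`B/(J ⊔ K)` has `x − y = j + k'`, and `x − j = y + k'` reduces to both; two lifts differ by an element of `J ⊓ K`),
and packages it for objects of `Art_k` (`ArtAlg.isCartesian_ofQuotient_inf`: for `B ∈ Art_k` and proper ideals
`J, K` all four quotients are objects of `Art_k` — `J ⊔ K ≤ 𝔪_B` is proper too, `ArtAlg.sup_ne_top`), which is the
form Schlessinger's (H₁)/(H₄) (`T1Lifting.lean`'s `ArtinFunctor.H1`/`H4`, quantified over cartesian squares in
`Art_k`) consume. THEOREMS only; no definition, no named fact, no `sorry`. Not here: the surrounding induction of the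
hull construction (see the lineage HANDOFF memo).

## References

* [Schlessinger1968] M. Schlessinger, Functors of Artin rings, Trans. Amer. Math. Soc. 130 (1968) 208–222: §1 p. 209
  (fibre products in `C`), proof of Thm. 2.11 (1), p. 214.
* [StacksProject] The Stacks Project, Tag 06GH (fibre products in `𝒞_Λ`).
-/

namespace Literature.AlgebraicGeometry.Deformation

universe u

open IsLocalRing

section QuotientInf

variable {k : Type u} [Field k]

/-- **`B/J ×_{B/(J+K)} B/K ≅ B/(J ∩ K)`:** for ideals `J, K` of a commutative `k`-algebra `B`, the square of canonical
projections `B/(J ⊓ K) → B/J → B/(J ⊔ K)`, `B/(J ⊓ K) → B/K → B/(J ⊔ K)` is cartesian.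
[cite: Schlessinger1968, proof of Thm. 2.11 (1), p. 214] [cite: StacksProject, Tag 06GH] -/
theorem Ideal.isCartesian_quotient_inf {B : Type u} [CommRing B] [Algebra k B] (J K : Ideal B) :
    IsCartesian k (Ideal.Quotient.factorₐ k (le_sup_left : J ≤ J ⊔ K))
      (Ideal.Quotient.factorₐ k (le_sup_right : K ≤ J ⊔ K))
      (Ideal.Quotient.factorₐ k (inf_le_left : J ⊓ K ≤ J))
      (Ideal.Quotient.factorₐ k (inf_le_right : J ⊓ K ≤ K)) where
  comm := by
    refine Ideal.Quotient.algHom_ext k ?_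
    ext x
    rfl
  exists_lift := by
    intro b a hba
    obtain ⟨x, rfl⟩ := Ideal.Quotient.mk_surjective b
    obtain ⟨y, rfl⟩ := Ideal.Quotient.mk_surjective a
    have hxy : x - y ∈ J ⊔ K := by
      rw [← Ideal.Quotient.eq]
      exact hba
    obtain ⟨j, hj, k', hk', hjk⟩ := Submodule.mem_sup.mp hxy
    refine ⟨Ideal.Quotient.mk (J ⊓ K) (x - j), ?_, ?_⟩
    · change Ideal.Quotient.mk J (x - j) = Ideal.Quotient.mk J x
      rw [Ideal.Quotient.eq]
      simpa using J.neg_mem hj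
    · change Ideal.Quotient.mk K (x - j) = Ideal.Quotient.mk K y
      rw [Ideal.Quotient.eq]
      have : x - j - y = k' := by linear_combination -hjk
      simpa [this] using hk'
  lift_unique := by
    intro d d' hq hp
    obtain ⟨x, rfl⟩ := Ideal.Quotient.mk_surjective d
    obtain ⟨x', rfl⟩ := Ideal.Quotient.mk_surjective d'
    change Ideal.Quotient.mk J x = Ideal.Quotient.mk J x' at hq
    change Ideal.Quotient.mk K x = Ideal.Quotient.mk K x' at hp
    rw [Ideal.Quotient.eq] at hq hp ⊢
    exact ⟨hq, hp⟩

/-- In an object `B` of `Art_k` the sum of two proper ideals is proper (both lie in `𝔪_B`).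
[cite: Schlessinger1968, §1 p. 208 («Artinian local `Λ`-algebras»)] -/
theorem ArtAlg.sup_ne_top (B : ArtAlg.{u} k) {J K : Ideal ↥B} (hJ : J ≠ ⊤) (hK : K ≠ ⊤) : J ⊔ K ≠ ⊤ := fun h =>
  IsLocalRing.maximalIdeal.isMaximal ↥B |>.ne_top
    (top_le_iff.mp (h ▸ sup_le (IsLocalRing.le_maximalIdeal hJ) (IsLocalRing.le_maximalIdeal hK)))

/-- The intersection of two proper ideals is proper. [cite: Schlessinger1968, §1 p. 208] -/
theorem ArtAlg.inf_ne_top (B : ArtAlg.{u} k) {J K : Ideal ↥B} (hJ : J ≠ ⊤) (_hK : K ≠ ⊤) : J ⊓ K ≠ ⊤ :=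
  fun h => hJ (top_le_iff.mp (h ▸ inf_le_left))

/-- **[Schlessinger1968, p. 214] in `Art_k`: `B/J ×_{B/(J+K)} B/K ≅ B/(J ∩ K)`** — for `B ∈ Art_k` and proper
ideals `J, K`, the four quotients are objects of `Art_k` (`ArtAlg.ofQuotient`) and the square of projections is
cartesian; this is the shape consumed by (H₁)/(H₄) of `T1Lifting.lean`.
[cite: Schlessinger1968, proof of Thm. 2.11 (1), p. 214] [cite: StacksProject, Tag 06GH] -/
theorem ArtAlg.isCartesian_ofQuotient_inf (B : ArtAlg.{u} k) (J K : Ideal ↥B) (hJ : J ≠ ⊤) (hK : K ≠ ⊤) :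
    IsCartesian k (R₀ := ↥(B.ofQuotient (J ⊔ K) (B.sup_ne_top hJ hK))) (R₁ := ↥(B.ofQuotient J hJ))
      (R₂ := ↥(B.ofQuotient K hK)) (R₃ := ↥(B.ofQuotient (J ⊓ K) (B.inf_ne_top hJ hK)))
      (Ideal.Quotient.factorₐ k (le_sup_left : J ≤ J ⊔ K))
      (Ideal.Quotient.factorₐ k (le_sup_right : K ≤ J ⊔ K))
      (Ideal.Quotient.factorₐ k (inf_le_left : J ⊓ K ≤ J))
      (Ideal.Quotient.factorₐ k (inf_le_right : J ⊓ K ≤ K)) :=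
  Ideal.isCartesian_quotient_inf J K

end QuotientInf

end Literature.AlgebraicGeometry.Deformation
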